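import Literature.MathematicalPhysics.QuantumManyBody.EliashbergTcCeilingSharp

/-!
# The Eliashberg `T_c` ceiling with a three-level weight: `k_B T_c ≤ ħ (λ⟨ω²⟩/28)^{1/2} = 0.1890 (λ⟨ω²⟩)^{1/2}`

Third file of the series `EliashbergTcCeiling` (`(λ⟨ω²⟩/12)^{1/2} = 0.2887…`, any `Z` convention) and
`EliashbergTcCeilingSharp` (`(2λ⟨ω²⟩/49)^{1/2} = 0.2020…`, full-line `Z`). The weighted Collatz–Wielandt
row test [cite: HornJohnson2013, Thm. 8.1.26, Cor. 8.1.29] is run with the three-level weight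
`p_n = d_n^{1/2} w_n`, `w = (1, 6/25, 9/100, 9/100, …)`: rows `0` and `1` of the Toeplitz-plus-Hankel
phonon matrix are treated exactly (entry by entry against `λ(k) ≤ A/(2πTk)²`, `A = Σ_i λ_i ω_i² = λ⟨ω²⟩`,
and the shifted `ζ(2)` tails `Σ_{k≥j} k^{-2} = π²/6 − Σ_{i<j} i^{-2}`), rows `n ≥ 2` uniformly; the three
row conditions close as soon as `28 T² > A`. Hence, for the full-line mass-renormalisation convention
`d_n = 2n+1 + λ(0) + 2Σ_{k≤n} λ(k)` [cite: AllenDynes1975, Eqs. (9)–(12)], every `μ* ≥ 0`, cutoff and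
Matsubara count,

  `k_B T_c ≤ ħ (λ⟨ω²⟩/28)^{1/2} = 0.18898 (λ⟨ω²⟩)^{1/2} = 1.034 × 0.18273 (λ⟨ω²⟩)^{1/2}`,

i.e. the Allen–Dynes large-`λ` law [cite: AllenDynes1975, Eq. (26)] is a rigorous CEILING up to `3.4 %`
(the printed rigorous bound [cite: KiesslingAltshulerYuzbashyan2025II, Thm. 6] is `2.03 ×` the law).
Finer weights would approach the sharp constant; the gain is no longer worth the bookkeeping.

* `sum_range_le_head2_add_shift` — `Σ_{m<N} g m ≤ g 0 + g 1 + Σ_{m<N} g (m+2)` for `g ≥ 0`;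
* `sum_range_inv_add_sq_le` — `Σ_{k<M} (k+j)^{-2} ≤ π²/6 − Σ_{i<j} i^{-2}`;
* `sum_matsubaraCoupling_shift_le` — the shifted row tails at temperature `T`;
* `weightedRow3_zero_lt`, `weightedRow3_one_lt`, `weightedRow3_ge_two_lt` — the three row conditions;
* `eliashbergTopEigenvalue_lt_one_sharp3`, `eliashbergTc_le_sqrt_sharp3` — assembly, threshold form.

## References
* [AllenDynes1975] P. B. Allen, R. C. Dynes, Phys. Rev. B 12 (1975) 905 — Eqs. (9)–(12), Eq. (26).
* [KiesslingAltshulerYuzbashyan2025II] M. K.-H. Kiessling, B. L. Altshuler, E. A. Yuzbashyan, J. Stat.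
  Phys. 192 (2025), doi:10.1007/s10955-025-03468-z (arXiv:2409.00532) — Thm. 6.
* [HornJohnson2013] R. A. Horn, C. R. Johnson, *Matrix Analysis*, 2nd ed., CUP 2013 — Thm. 8.1.26,
  Cor. 8.1.29.
-/

noncomputable section

open scoped Matrix

namespace Literature.MathematicalPhysics.QuantumManyBody

open Finset _root_.Matrix Literature.Analysis.Matrix Real

/-! ### Finite-sum helpers -/

section Helpers

/-- `Σ_{m<N} g(m) ≤ g(0) + g(1) + Σ_{m<N} g(m+2)` for `g ≥ 0` (enlarge `range N` to `range (N+2)` and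
split off the first two terms). [folklore] -/
private theorem sum_range_le_head2_add_shift {g : ℕ → ℝ} (hg : ∀ m, 0 ≤ g m) (N : ℕ) :
    ∑ m ∈ Finset.range N, g m ≤ g 0 + g 1 + ∑ m ∈ Finset.range N, g (m + 2) := by
  have h1 : ∑ m ∈ Finset.range N, g m ≤ ∑ m ∈ Finset.range (N + 2), g m :=
    Finset.sum_le_sum_of_subset_of_nonneg (Finset.range_mono (by omega)) fun m _ _ => hg m
  have h2 : ∑ m ∈ Finset.range (N + 2), g m = g 0 + g 1 + ∑ m ∈ Finset.range N, g (m + 2) := by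
    rw [Finset.sum_range_succ', Finset.sum_range_succ']
    ring
  linarith

/-- `Σ_{m<N+2} g(m) = g(0) + g(1) + Σ_{m<N} g(m+2)`. [folklore] -/
private theorem sum_range_add_two_eq (g : ℕ → ℝ) (N : ℕ) :
    ∑ m ∈ Finset.range (N + 2), g m = g 0 + g 1 + ∑ m ∈ Finset.range N, g (m + 2) := by
  rw [Finset.sum_range_succ', Finset.sum_range_succ']
  ring

/-- **Shifted `ζ(2)` tails**: `Σ_{k<M} 1/(k+j)² ≤ π²/6 − Σ_{i<j} 1/i²` (`hasSum_zeta_two`; the `i = 0` term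
is `1/0 = 0`). [folklore] -/
private theorem sum_range_inv_add_sq_le (j M : ℕ) :
    ∑ k ∈ Finset.range M, 1 / ((k : ℝ) + j) ^ 2 ≤
      π ^ 2 / 6 - ∑ i ∈ Finset.range j, 1 / (i : ℝ) ^ 2 := by
  have h := sum_le_hasSum (Finset.range (j + M)) (fun n _ => by positivity) hasSum_zeta_two
  rw [Finset.sum_range_add] at h
  have e : ∀ k : ℕ, ((j + k : ℕ) : ℝ) = (k : ℝ) + j := fun k => by push_cast; ring
  simp only [e] at h
  linarith

end Helpers

/-! ### Shifted row tails at temperature `T` -/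

section Tails

variable {κ : Type*}

/-- **Shifted row tails.** For `1 ≤ j₀ ≤ j`: `Σ_{k<M} λ(k+j; T) ≤ (A/(2πT)²)(π²/6 − Σ_{i<j₀} i^{-2})`
(`λ(k+j) ≤ A/(2πT(k+j))² ≤ A/(2πT)² (k+j₀)^{-2}`). [cite: AllenDynes1975, Eqs. (9)–(12)] -/
theorem sum_matsubaraCoupling_shift_le (s : Finset κ) {l : κ → ℝ} (ω : κ → ℝ)
    (hl : ∀ i ∈ s, 0 ≤ l i) {T : ℝ} (hT : 0 < T) {j₀ j : ℕ} (hj₀ : 1 ≤ j₀) (hj : j₀ ≤ j) (M : ℕ) :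
    ∑ k ∈ Finset.range M, ∑ i ∈ s, l i * (ω i ^ 2 / (ω i ^ 2 + (2 * π * T * (k + j : ℕ)) ^ 2)) ≤
      (∑ i ∈ s, l i * ω i ^ 2) / (2 * π * T) ^ 2 *
        (π ^ 2 / 6 - ∑ i ∈ Finset.range j₀, 1 / (i : ℝ) ^ 2) := by
  set A := ∑ i ∈ s, l i * ω i ^ 2 with hA
  have hA0 : 0 ≤ A := Finset.sum_nonneg fun i hi => mul_nonneg (hl i hi) (sq_nonneg _)
  have hstep : ∀ k ∈ Finset.range M,
      ∑ i ∈ s, l i * (ω i ^ 2 / (ω i ^ 2 + (2 * π * T * (k + j : ℕ)) ^ 2)) ≤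
        A / (2 * π * T) ^ 2 * (1 / ((k : ℝ) + j₀) ^ 2) := fun k _ => by
    have h := matsubaraCouplingDiscrete_le s ω hl hT (k := k + j) (by omega)
    refine h.trans ?_
    have hkj : (k : ℝ) + j₀ ≤ ((k + j : ℕ) : ℝ) := by push_cast; exact_mod_cast (by omega : k + j₀ ≤ k + j)
    have hpos : 0 < (k : ℝ) + j₀ := by
      have : (1 : ℝ) ≤ j₀ := by exact_mod_cast hj₀
      positivity
    rw [show (2 * π * T * ((k + j : ℕ) : ℝ)) ^ 2 = (2 * π * T) ^ 2 * ((k + j : ℕ) : ℝ) ^ 2 by ring,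
      ← div_div, mul_one_div]
    exact div_le_div_of_nonneg_left (div_nonneg hA0 (by positivity)) (by positivity)
      (pow_le_pow_left₀ hpos.le hkj 2)
  calc _ ≤ ∑ k ∈ Finset.range M, A / (2 * π * T) ^ 2 * (1 / ((k : ℝ) + j₀) ^ 2) := Finset.sum_le_sum hstep
    _ = A / (2 * π * T) ^ 2 * ∑ k ∈ Finset.range M, 1 / ((k : ℝ) + j₀) ^ 2 := by rw [Finset.mul_sum]
    _ ≤ _ := mul_le_mul_of_nonneg_left (sum_range_inv_add_sq_le j₀ M) (by positivity)

end Tails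

/-! ### The three row conditions for the weight `(1, v₁, v₂, v₂, …)` -/

section Rows

/-- **Row `0`.** `Σ_{m<N} Λ_{0m} w_m ≤ λ(0) + λ(1) + v₁(λ(1)+λ(2)) + v₂(T₂ + T₃) < d_0` as soon as
`λ(1) + v₁(λ(1)+λ(2)) + v₂(T₂+T₃) < 1`, `T_j` a bound of the partial sums of `λ(j), λ(j+1), …` and
`d_0 ≥ 1 + λ(0)`. [cite: AllenDynes1975, Eqs. (9)–(12)] -/
theorem weightedRow3_zero_lt {lam : ℕ → ℝ} (hlam : ∀ k, 0 ≤ lam k) {v₁ v₂ T₂ T₃ d0 : ℝ}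
    (hv₁ : 0 ≤ v₁) (hv₂ : 0 ≤ v₂)
    (hT₂ : ∀ M, ∑ k ∈ Finset.range M, lam (k + 2) ≤ T₂)
    (hT₃ : ∀ M, ∑ k ∈ Finset.range M, lam (k + 3) ≤ T₃)
    (h0 : lam 1 + v₁ * (lam 1 + lam 2) + v₂ * (T₂ + T₃) < 1) (hd : 1 + lam 0 ≤ d0) (N : ℕ) :
    ∑ m ∈ Finset.range N, (lam (Nat.dist 0 m) + lam (0 + m + 1)) *
        (if m = 0 then (1:ℝ) else if m = 1 then v₁ else v₂) < d0 * 1 := by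
  set g : ℕ → ℝ := fun m => (lam (Nat.dist 0 m) + lam (0 + m + 1)) *
    (if m = 0 then (1:ℝ) else if m = 1 then v₁ else v₂) with hg
  have hw : ∀ m : ℕ, 0 ≤ (if m = 0 then (1:ℝ) else if m = 1 then v₁ else v₂) := fun m => by
    split_ifs <;> linarith
  have hgnn : ∀ m, 0 ≤ g m := fun m => mul_nonneg (add_nonneg (hlam _) (hlam _)) (hw m)
  have hle := sum_range_le_head2_add_shift hgnn N
  have e0 : g 0 = lam 0 + lam 1 := by simp [hg, Nat.dist_zero_left]
  have e1 : g 1 = (lam 1 + lam 2) * v₁ := by simp [hg, Nat.dist_zero_left]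
  have e2 : ∀ m : ℕ, g (m + 2) = (lam (m + 2) + lam (m + 3)) * v₂ := fun m => by
    simp only [hg]
    rw [if_neg (by omega), if_neg (by omega), Nat.dist_zero_left, Nat.zero_add]
  have hs : ∑ m ∈ Finset.range N, g (m + 2) ≤ v₂ * (T₂ + T₃) := by
    rw [Finset.sum_congr rfl fun m _ => e2 m, ← Finset.sum_mul, mul_comm, Finset.sum_add_distrib]
    exact mul_le_mul_of_nonneg_left (add_le_add (hT₂ N) (hT₃ N)) hv₂
  have : ∑ m ∈ Finset.range N, g m < d0 * 1 := by rw [e0, e1] at hle; nlinarith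
  simpa only [hg] using this

/-- **Row `1`.** `Σ_{m<N} Λ_{1m} w_m ≤ (λ(1)+λ(2)) + v₁(λ(0)+λ(3)) + v₂(T₁ + T₄) < v₁ d_1` as soon as
`λ(1)(1−2v₁) + λ(2) + v₁λ(3) + v₂(T₁+T₄) < 3v₁` and `d_1 ≥ 3 + λ(0) + 2λ(1)` (`λ(0)` cancels).
[cite: AllenDynes1975, Eqs. (9)–(12)] -/
theorem weightedRow3_one_lt {lam : ℕ → ℝ} (hlam : ∀ k, 0 ≤ lam k) {v₁ v₂ T₁ T₄ d1 : ℝ}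
    (hv₁ : 0 ≤ v₁) (hv₂ : 0 ≤ v₂)
    (hT₁ : ∀ M, ∑ k ∈ Finset.range M, lam (k + 1) ≤ T₁)
    (hT₄ : ∀ M, ∑ k ∈ Finset.range M, lam (k + 4) ≤ T₄)
    (h1 : lam 1 * (1 - 2 * v₁) + lam 2 + v₁ * lam 3 + v₂ * (T₁ + T₄) < 3 * v₁)
    (hd : (2 * ((1 : ℕ) : ℝ) + 1) + lam 0 + 2 * ∑ k ∈ Finset.range 1, lam (k + 1) ≤ d1) (N : ℕ) :
    ∑ m ∈ Finset.range N, (lam (Nat.dist 1 m) + lam (1 + m + 1)) *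
        (if m = 0 then (1:ℝ) else if m = 1 then v₁ else v₂) < d1 * v₁ := by
  set g : ℕ → ℝ := fun m => (lam (Nat.dist 1 m) + lam (1 + m + 1)) *
    (if m = 0 then (1:ℝ) else if m = 1 then v₁ else v₂) with hg
  have hw : ∀ m : ℕ, 0 ≤ (if m = 0 then (1:ℝ) else if m = 1 then v₁ else v₂) := fun m => by
    split_ifs <;> linarith
  have hgnn : ∀ m, 0 ≤ g m := fun m => mul_nonneg (add_nonneg (hlam _) (hlam _)) (hw m)
  have hle := sum_range_le_head2_add_shift hgnn N
  have e0 : g 0 = lam 1 + lam 2 := by simp [hg, Nat.dist_zero_right]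
  have e1 : g 1 = (lam 0 + lam 3) * v₁ := by simp [hg, Nat.dist_self]
  have e2 : ∀ m : ℕ, g (m + 2) = (lam (m + 1) + lam (m + 4)) * v₂ := fun m => by
    have hd' : Nat.dist 1 (m + 2) = m + 1 := by rw [Nat.dist_eq_sub_of_le (by omega)]; omega
    have ha : 1 + (m + 2) + 1 = m + 4 := by omega
    simp only [hg]
    rw [if_neg (by omega), if_neg (by omega), hd', ha]
  have hs : ∑ m ∈ Finset.range N, g (m + 2) ≤ v₂ * (T₁ + T₄) := by
    rw [Finset.sum_congr rfl fun m _ => e2 m, ← Finset.sum_mul, mul_comm, Finset.sum_add_distrib]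
    exact mul_le_mul_of_nonneg_left (add_le_add (hT₁ N) (hT₄ N)) hv₂
  simp only [Finset.sum_range_one, Nat.cast_one, zero_add] at hd
  have : ∑ m ∈ Finset.range N, g m < d1 * v₁ := by
    rw [e0, e1] at hle; nlinarith [hlam 0]
  simpa only [hg] using this

/-- **Rows `n ≥ 2`.** `Σ_{m<N} Λ_{nm} w_m ≤ (1−v₂)Λ_{n0} + (v₁−v₂)Λ_{n1} + v₂ Σ_{m<N+2} Λ_{nm} < v₂ d_n` as
soon as `(1−v₂)F₀ + (v₁−v₂)F₁ + 2v₂T < 5v₂`, where `F₀ ≥ λ(n)+λ(n+1)`, `F₁ ≥ λ(n−1)+λ(n+2)`, `T` bounds the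
row tail (partial sums of `λ(n+1), …`), `0 ≤ v₂ ≤ v₁`, `v₂ ≤ 1`, full-line `d_n`.
[cite: AllenDynes1975, Eqs. (9)–(12)] -/
theorem weightedRow3_ge_two_lt {lam : ℕ → ℝ} (hlam : ∀ k, 0 ≤ lam k) {v₁ v₂ F₀ F₁ Tn dn : ℝ}
    (hv₂ : 0 < v₂) (hv₂1 : v₂ ≤ 1) (hv12 : v₂ ≤ v₁) {n : ℕ} (hn : 2 ≤ n)
    (hF₀ : lam n + lam (n + 1) ≤ F₀) (hF₁ : lam (n - 1) + lam (n + 2) ≤ F₁)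
    (hT : ∀ M, ∑ k ∈ Finset.range M, lam (k + n + 1) ≤ Tn)
    (h2 : (1 - v₂) * F₀ + (v₁ - v₂) * F₁ + 2 * v₂ * Tn < 5 * v₂)
    (hd : (2 * (n : ℝ) + 1) + lam 0 + 2 * ∑ k ∈ Finset.range n, lam (k + 1) ≤ dn) (N : ℕ) :
    ∑ m ∈ Finset.range N, (lam (Nat.dist n m) + lam (n + m + 1)) *
        (if m = 0 then (1:ℝ) else if m = 1 then v₁ else v₂) < dn * v₂ := by
  set F : ℕ → ℝ := fun m => lam (Nat.dist n m) + lam (n + m + 1) with hF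
  set g : ℕ → ℝ := fun m => F m * (if m = 0 then (1:ℝ) else if m = 1 then v₁ else v₂) with hg
  have hw : ∀ m : ℕ, 0 ≤ (if m = 0 then (1:ℝ) else if m = 1 then v₁ else v₂) := fun m => by
    split_ifs <;> linarith
  have hFnn : ∀ m, 0 ≤ F m := fun m => add_nonneg (hlam _) (hlam _)
  have hgnn : ∀ m, 0 ≤ g m := fun m => mul_nonneg (hFnn m) (hw m)
  have hle := sum_range_le_head2_add_shift hgnn N
  have e0 : g 0 = F 0 := by simp [hg]
  have e1 : g 1 = F 1 * v₁ := by simp [hg]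
  have e2 : ∀ m : ℕ, g (m + 2) = F (m + 2) * v₂ := fun m => by
    simp only [hg]
    rw [if_neg (by omega), if_neg (by omega)]
  have hF0 : F 0 = lam n + lam (n + 1) := by simp [hF, Nat.dist_zero_right]
  have hF1 : F 1 = lam (n - 1) + lam (n + 2) := by
    simp only [hF]; rw [Nat.dist_eq_sub_of_le_right (by omega)]
  -- the total row sum over range (N+2), via the refined Toeplitz lemma and the Hankel tail
  have htoe := sum_range_toeplitz_le_tail hlam n hT (N + 2)
  have hhan : ∑ m ∈ Finset.range (N + 2), lam (n + m + 1) ≤ Tn :=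
    (Finset.sum_congr rfl fun m _ => by congr 1; omega).trans_le (hT (N + 2))
  have htot : ∑ m ∈ Finset.range (N + 2), F m ≤
      lam 0 + 2 * (∑ k ∈ Finset.range n, lam (k + 1)) + 2 * Tn := by
    simp only [hF]; rw [Finset.sum_add_distrib]; linarith
  have hshift : ∑ m ∈ Finset.range N, F (m + 2) = (∑ m ∈ Finset.range (N + 2), F m) - F 0 - F 1 := by
    rw [sum_range_add_two_eq]; ring
  have hs : ∑ m ∈ Finset.range N, g (m + 2) = v₂ * ((∑ m ∈ Finset.range (N + 2), F m) - F 0 - F 1) := by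
    rw [Finset.sum_congr rfl fun m _ => e2 m, ← Finset.sum_mul, mul_comm, hshift]
  have hhead : 0 ≤ ∑ k ∈ Finset.range n, lam (k + 1) := Finset.sum_nonneg fun k _ => hlam _
  have hn5 : (5 : ℝ) ≤ 2 * (n : ℝ) + 1 := by
    have : (2 : ℝ) ≤ n := by exact_mod_cast hn
    linarith
  have : ∑ m ∈ Finset.range N, g m < dn * v₂ := by
    rw [e0, e1, hs] at hle
    set S := ∑ m ∈ Finset.range (N + 2), F m with hS
    set H := ∑ k ∈ Finset.range n, lam (k + 1) with hH
    -- total ≤ (1 - v₂) F0 + (v₁ - v₂) F1 + v₂ S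
    have h1 : ∑ m ∈ Finset.range N, g m ≤ (1 - v₂) * F 0 + (v₁ - v₂) * F 1 + v₂ * S := by
      linarith
    have h2 : v₂ * S ≤ v₂ * (lam 0 + 2 * H + 2 * Tn) := mul_le_mul_of_nonneg_left htot hv₂.le
    have h3 : (1 - v₂) * F 0 ≤ (1 - v₂) * F₀ := by
      rw [hF0]; exact mul_le_mul_of_nonneg_left hF₀ (by linarith)
    have h4 : (v₁ - v₂) * F 1 ≤ (v₁ - v₂) * F₁ := by
      rw [hF1]; exact mul_le_mul_of_nonneg_left hF₁ (by linarith)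
    have h5 : v₂ * (2 * (n : ℝ) + 1 + lam 0 + 2 * H) ≤ dn * v₂ := by nlinarith [hd, hv₂]
    have h6 : 5 * v₂ ≤ v₂ * (2 * (n : ℝ) + 1) := by nlinarith [hn5, hv₂]
    nlinarith [h1, h2, h3, h4, h5, h6, h2]
  simpa only [hg, hF] using this

end Rows

/-! ### Assembly -/

section Assembly

variable {κ : Type*} {N : ℕ}

/-- The numerical heart for `w = (1, 6/25, 9/100, …)`: with `B = A/(2πT)²`, `τ₁ = A/(24T²)` and
`28T² > A`, the three row conditions hold (uses `π > 3.141592`). [folklore] -/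
private theorem row3_constants {A T : ℝ} (hA0 : 0 ≤ A) (hT : 0 < T) (hA : A < 28 * T ^ 2) :
    let B := A / (2 * π * T) ^ 2
    let τ₁ := A / (24 * T ^ 2)
    B + 6 / 25 * (B + B / 4) + 9 / 100 * ((τ₁ - B) + (τ₁ - B - B / 4)) < 1 ∧
    B * (1 - 2 * (6 / 25)) + B / 4 + 6 / 25 * (B / 9) + 9 / 100 * (τ₁ + (τ₁ - B - B / 4 - B / 9))
      < 3 * (6 / 25) ∧
    (1 - 9 / 100) * (B / 4 + B / 9) + (6 / 25 - 9 / 100) * (B + B / 16) +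
      2 * (9 / 100) * (τ₁ - B - B / 4) < 5 * (9 / 100) := by
  intro B τ₁
  have hπ := Real.pi_gt_d6
  have hT2 : 0 < T ^ 2 := by positivity
  set a := A / T ^ 2 with ha
  have ha0 : 0 ≤ a := div_nonneg hA0 hT2.le
  have ha1 : a < 28 := by rw [ha, div_lt_iff₀ hT2]; linarith
  have hπ2 : (24674 / 625 : ℝ) < 4 * π ^ 2 := by nlinarith
  have hB : B = a / (4 * π ^ 2) := by show A / (2 * π * T) ^ 2 = _; rw [ha]; field_simp; ring
  have hτ : τ₁ = a / 24 := by show A / (24 * T ^ 2) = _; rw [ha]; field_simp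
  have hX : a / (4 * π ^ 2) ≤ a * (625 / 24674) := by
    rw [div_le_iff₀ (by positivity)]
    nlinarith [mul_nonneg ha0 (sub_nonneg.mpr hπ2.le)]
  have hXnn : 0 ≤ a / (4 * π ^ 2) := by positivity
  rw [hB, hτ]
  refine ⟨?_, ?_, ?_⟩ <;> linarith

/-- **The three-level ceiling at one temperature (full-line `Z` convention).** For a discrete
Eliashberg function `(λ_i ≥ 0, ω_i)`, a temperature with `28T² > A = Σ_i λ_i ω_i²`, any cutoff `N`, any
`μ ≥ 0` and weights `d_n ≥ 2n+1 + λ(0) + 2Σ_{k=1}^{n} λ(k)`, the top eigenvalue of the symmetrised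
linearised isotropic Eliashberg kernel is `< 1`. [cite: AllenDynes1975, Eqs. (9)–(12)] -/
theorem eliashbergTopEigenvalue_lt_one_sharp3 (s : Finset κ) (l ω : κ → ℝ) (hl : ∀ i ∈ s, 0 ≤ l i)
    {T : ℝ} (hT : 0 < T) (hA : ∑ i ∈ s, l i * ω i ^ 2 < 28 * T ^ 2)
    (lam : ℕ → ℝ) (hlam : ∀ k : ℕ, lam k = ∑ i ∈ s, l i * (ω i ^ 2 / (ω i ^ 2 + (2 * π * T * k) ^ 2)))
    (Λ : Matrix (Fin N) (Fin N) ℝ)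
    (hΛ : ∀ n m : Fin N, Λ n m = lam (Nat.dist n m) + lam ((n : ℕ) + m + 1))
    (d : Fin N → ℝ)
    (hd : ∀ n : Fin N, (2 * ((n : ℕ) : ℝ) + 1) + lam 0 + 2 * ∑ k ∈ Finset.range n, lam (k + 1) ≤ d n)
    (S₀ : Matrix (Fin N) (Fin N) ℝ) (hS₀ : S₀.IsHermitian)
    (hS : ∀ n m, S₀ n m = Λ n m / (Real.sqrt (d n) * Real.sqrt (d m)))
    (sv : Fin N → ℝ) {μ : ℝ} (hμ : 0 ≤ μ) (hn : 1 ≤ Fintype.card (Fin N)) :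
    (isHermitian_rankOneDownshift hS₀ sv μ).eigenvalues₀ (Fin.castLE hn 0) < 1 := by
  set A := ∑ i ∈ s, l i * ω i ^ 2 with hAdef
  have hA0 : 0 ≤ A := Finset.sum_nonneg fun i hi => mul_nonneg (hl i hi) (sq_nonneg _)
  have hlam0 : ∀ k, 0 ≤ lam k := fun k => by
    rw [hlam]; exact matsubaraCouplingDiscrete_nonneg s ω hl T k
  set B := A / (2 * π * T) ^ 2 with hBdef
  have hB0 : 0 ≤ B := by positivity
  have hlamk : ∀ k : ℕ, 1 ≤ k → lam k ≤ B / (k : ℝ) ^ 2 := fun k hk => by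
    rw [hlam]
    refine (matsubaraCouplingDiscrete_le s ω hl hT hk).trans (le_of_eq ?_)
    rw [hBdef, hAdef]; field_simp
  -- single entries
  have hl1 : lam 1 ≤ B := by simpa using hlamk 1 le_rfl
  have hl2 : lam 2 ≤ B / 4 := by have := hlamk 2 (by norm_num); norm_num at this; exact this
  have hl3 : lam 3 ≤ B / 9 := by have := hlamk 3 (by norm_num); norm_num at this; exact this
  have hlam_sq : ∀ k : ℕ, ∀ c : ℝ, 1 ≤ k → (c : ℝ) ≤ k → 0 < c → lam k ≤ B / c ^ 2 := fun k c hk hck hc =>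
    (hlamk k hk).trans (div_le_div_of_nonneg_left hB0 (by positivity) (pow_le_pow_left₀ hc.le hck 2))
  -- tails: τ_j = B (π²/6 − H_{j−1})
  set τ₁ := A / (24 * T ^ 2) with hτ₁def
  have hτB : B * (π ^ 2 / 6) = τ₁ := by rw [hBdef, hτ₁def]; field_simp; ring
  have htail : ∀ j₀ j : ℕ, 1 ≤ j₀ → j₀ ≤ j → ∀ M, ∑ k ∈ Finset.range M, lam (k + j) ≤
      B * (π ^ 2 / 6 - ∑ i ∈ Finset.range j₀, 1 / (i : ℝ) ^ 2) := fun j₀ j hj₀ hj M => by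
    have h := sum_matsubaraCoupling_shift_le s ω hl hT hj₀ hj M
    refine le_of_eq_of_le (Finset.sum_congr rfl fun k _ => ?_) h
    rw [hlam]
  have hT1 : ∀ M, ∑ k ∈ Finset.range M, lam (k + 1) ≤ τ₁ := fun M => by
    have h := htail 1 1 le_rfl le_rfl M; simp at h; linarith [hτB]
  have hT2 : ∀ M, ∑ k ∈ Finset.range M, lam (k + 2) ≤ τ₁ - B := fun M => by
    have h := htail 2 2 (by norm_num) le_rfl M
    simp [Finset.sum_range_succ] at h; linarith [hτB]
  have hT3 : ∀ M, ∑ k ∈ Finset.range M, lam (k + 3) ≤ τ₁ - B - B / 4 := fun M => by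
    have h := htail 3 3 (by norm_num) le_rfl M
    simp [Finset.sum_range_succ] at h; norm_num at h; linarith [hτB]
  have hT4 : ∀ M, ∑ k ∈ Finset.range M, lam (k + 4) ≤ τ₁ - B - B / 4 - B / 9 := fun M => by
    have h := htail 4 4 (by norm_num) le_rfl M
    simp [Finset.sum_range_succ] at h; norm_num at h; linarith [hτB]
  have hTn : ∀ n : ℕ, 2 ≤ n → ∀ M, ∑ k ∈ Finset.range M, lam (k + n + 1) ≤ τ₁ - B - B / 4 := fun n hn2 M => by
    have h := htail 3 (n + 1) (by norm_num) (by omega) M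
    simp [Finset.sum_range_succ] at h; norm_num at h
    have e : ∑ k ∈ Finset.range M, lam (k + n + 1) = ∑ k ∈ Finset.range M, lam (k + (n + 1)) :=
      Finset.sum_congr rfl fun k _ => by rw [add_assoc]
    rw [e]; linarith [hτB]
  obtain ⟨c0, c1, c2⟩ := row3_constants hA0 hT hA
  -- the weight
  set w : Fin N → ℝ := fun m => if (m : ℕ) = 0 then 1 else if (m : ℕ) = 1 then 6 / 25 else 9 / 100 with hw
  have hwpos : ∀ m, 0 < w m := fun m => by simp only [hw]; split_ifs <;> norm_num
  refine eigenvalues₀_max_lt_one_of_weightedRowDominance Λ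
    (fun n m => by rw [hΛ]; exact add_nonneg (hlam0 _) (hlam0 _)) d w hwpos ?_ S₀ hS₀ hS sv hμ hn
  intro n
  rw [Finset.sum_congr rfl fun m _ => by rw [hΛ n m],
    Fin.sum_univ_eq_sum_range
      (fun m => (lam (Nat.dist n m) + lam ((n : ℕ) + m + 1)) *
        (if m = 0 then (1:ℝ) else if m = 1 then 6 / 25 else 9 / 100)) N]
  rcases Nat.lt_or_ge (n : ℕ) 2 with hn2 | hn2
  · interval_cases hcase : (n : ℕ)
    · -- row 0
      have hw0 : w n = 1 := by simp only [hw]; rw [if_pos hcase]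
      rw [hw0]
      have hd0 : 1 + lam 0 ≤ d n := by have := hd n; rw [hcase] at this; simpa using this
      have h0 : lam 1 + 6 / 25 * (lam 1 + lam 2) + 9 / 100 * ((τ₁ - B) + (τ₁ - B - B / 4)) < 1 := by
        nlinarith
      exact weightedRow3_zero_lt hlam0 (by norm_num) (by norm_num) hT2 hT3 h0 hd0 N
    · -- row 1
      have hw1 : w n = 6 / 25 := by simp only [hw]; rw [if_neg (by omega), if_pos hcase]
      rw [hw1]
      have hd1 := hd n; rw [hcase] at hd1
      have h1 : lam 1 * (1 - 2 * (6 / 25)) + lam 2 + 6 / 25 * lam 3 +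
          9 / 100 * (τ₁ + (τ₁ - B - B / 4 - B / 9)) < 3 * (6 / 25) := by nlinarith
      exact weightedRow3_one_lt hlam0 (by norm_num) (by norm_num) hT1 hT4 h1 hd1 N
  · -- rows n ≥ 2
    have hwn : w n = 9 / 100 := by
      simp only [hw]; rw [if_neg (by omega), if_neg (by omega)]
    rw [hwn]
    have hF₀ : lam n + lam ((n : ℕ) + 1) ≤ B / 4 + B / 9 := by
      have h1 := hlam_sq n 2 (by omega) (by exact_mod_cast hn2) (by norm_num)
      have h2 := hlam_sq ((n : ℕ) + 1) 3 (by omega) (by push_cast; linarith [(show (2:ℝ) ≤ (n:ℕ) by exact_mod_cast hn2)]) (by norm_num)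
      norm_num at h1 h2; linarith
    have hF₁ : lam ((n : ℕ) - 1) + lam ((n : ℕ) + 2) ≤ B + B / 16 := by
      have h1 := hlam_sq ((n : ℕ) - 1) 1 (by omega) (by exact_mod_cast (by omega : 1 ≤ (n : ℕ) - 1)) (by norm_num)
      have h2 := hlam_sq ((n : ℕ) + 2) 4 (by omega) (by push_cast; linarith [(show (2:ℝ) ≤ (n:ℕ) by exact_mod_cast hn2)]) (by norm_num)
      norm_num at h1 h2; linarith
    have h2 : (1 - 9 / 100) * (B / 4 + B / 9) + (6 / 25 - 9 / 100) * (B + B / 16) +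
        2 * (9 / 100) * (τ₁ - B - B / 4) < 5 * (9 / 100) := c2
    exact weightedRow3_ge_two_lt hlam0 (by norm_num) (by norm_num) (by norm_num) hn2 hF₀ hF₁
      (hTn n hn2) h2 (hd n) N

/-- **`T_c ≤ (λ⟨ω²⟩/28)^{1/2} = 0.1890 (λ⟨ω²⟩)^{1/2}` for the linearised isotropic Migdal–Eliashberg
equations (full-line `Z`)** — threshold form; the Allen–Dynes asymptote is `0.1827 (λ⟨ω²⟩)^{1/2}`
(ratio `1.034`). [cite: AllenDynes1975, Eqs. (9)–(12) and (26)]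
[cite: KiesslingAltshulerYuzbashyan2025II, Thm. 6] -/
theorem eliashbergTc_le_sqrt_sharp3 {κ : Type*} (s : Finset κ) (l ω : κ → ℝ) (hl : ∀ i ∈ s, 0 ≤ l i)
    (ρ : ℝ → ℝ)
    (hρ : ∀ T : ℝ, Real.sqrt ((∑ i ∈ s, l i * ω i ^ 2) / 28) < T →
      ∃ (N : ℕ) (hn : 1 ≤ Fintype.card (Fin N)) (lam : ℕ → ℝ) (Λ : Matrix (Fin N) (Fin N) ℝ)
        (d : Fin N → ℝ) (S₀ : Matrix (Fin N) (Fin N) ℝ) (hS₀ : S₀.IsHermitian) (sv : Fin N → ℝ) (μ : ℝ),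
        (∀ k : ℕ, lam k = ∑ i ∈ s, l i * (ω i ^ 2 / (ω i ^ 2 + (2 * π * T * k) ^ 2))) ∧
        (∀ n m : Fin N, Λ n m = lam (Nat.dist n m) + lam ((n : ℕ) + m + 1)) ∧
        (∀ n : Fin N, (2 * ((n : ℕ) : ℝ) + 1) + lam 0 + 2 * ∑ k ∈ Finset.range n, lam (k + 1) ≤ d n) ∧
        (∀ n m, S₀ n m = Λ n m / (Real.sqrt (d n) * Real.sqrt (d m))) ∧ 0 ≤ μ ∧
        ρ T = (isHermitian_rankOneDownshift hS₀ sv μ).eigenvalues₀ (Fin.castLE hn 0)) :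
    BddAbove {T : ℝ | 0 < T ∧ 1 ≤ ρ T} ∧
      sSup {T : ℝ | 0 < T ∧ 1 ≤ ρ T} ≤ Real.sqrt ((∑ i ∈ s, l i * ω i ^ 2) / 28) := by
  refine sSup_superlevel_le_of_lt_one (Real.sqrt_nonneg _) fun T hT => ?_
  have hTpos : 0 < T := lt_of_le_of_lt (Real.sqrt_nonneg _) hT
  obtain ⟨N, hn, lam, Λ, d, S₀, hS₀, sv, μ, hlam, hΛ, hd, hS, hμ, hρT⟩ := hρ T hT
  rw [hρT]
  have hA : ∑ i ∈ s, l i * ω i ^ 2 < 28 * T ^ 2 := by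
    have := (Real.sqrt_lt' hTpos).mp hT
    linarith
  exact eliashbergTopEigenvalue_lt_one_sharp3 s l ω hl hTpos hA lam hlam Λ hΛ d hd S₀ hS₀ hS sv hμ hn

end Assembly

end Literature.MathematicalPhysics.QuantumManyBody
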